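import Summits.BirchSwinnertonDyer.BirchSwinnertonDyer.Theorems.ClassRecordThreeHalvesAtThreeValueContinuity
import Summits.BirchSwinnertonDyer.BirchSwinnertonDyer.Theorems.ClassRecordThreeIMCDivAtThreeB
import HarnessLib

/-!
# Route `ClassRecordThree`, crux `HalvesAtThree` (item 19107) ∕ H3 child 19494 — the children glue with the
# ORIENTATION-REPAIRED H3 atom `Three.IMCDivAt₃B`: (VC₃) ∧ «IMCDivTwoLociAtThreeR» ⟹ «HalvesAtThreeR»
# (plan g30 RULING 2 (G4); ORIENT-AUDIT-19270 form (a) at `p = 3`)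

Cell `bsd-stepL` (run/shared/lean/pub/bsd-stepL/), seat `bsd-stepL-bdp` (prover g16, 2026-08-27; fallback hand
for (G4)). `--supports stmt-BirchSwinnertonDyer-19494 --as helper`. Twin of thmc-p1's
`classRecordThree_halvesAtThree_of_valueContinuity_of_imcDivStub` (p421546) with the H3 hypothesis over
`Three.IMCDivAt₃B` (`Theorems/ClassRecordThreeIMCDivAtThreeB.lean`).

WHY THE CONCLUSION IS AN R-BODY, NOT `HalvesAtThree`: the registered parent `Theses.ClassRecordThree.HalvesAtThree`
contains the A-atom `Three.IMCDivAt₃ W` verbatim, which does NOT follow from the B-atom (the two differ by an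
unprinted `ι`-invariance — that is the content of the audit). So the glue over the repaired child can only
conclude the REPAIRED PARENT, spelled out here as its body «HalvesAtThreeR» := `∀ W, ClassX11b W 3 →
(Ram → 3 split → BDPValueAt₃ W ∧ IMCDivAt₃B W) ∧ (¬Ram → Surj → BDPValueAt₃ W ∧ IMCDivAt₃B W)` (no route decl of
that name exists yet; when the planner re-types 19107 ∕ 19494 to the R-texts, `…OfChildrenR_holds := fun hVC h3 ↦
classRecordThree_halvesAtThree_of_valueContinuity_of_imcDivStubB hVC h3` closes the generated glue by `rfl`-unfolding,
and `closes` re-certifies through `multiplicativeRankOneAtThree_of_classRecord_upperB`,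
`Theorems/ClassRecordThreeKernelUpperB.lean`).

* `classRecordThree_halvesAtThree_imcDiv_of_imcDivStubB` — bookkeeping: the R-child body, two loci.
* **`classRecordThree_halvesAtThree_of_valueContinuity_of_imcDivStubB`** — (VC₃) for every curve (INLINE, verbatim
  thmc-p1's `hVC` = the body of `Theses.ClassRecordThree.ValueContinuityAtThree`, item 19493, UNCHANGED by the
  repair) ∧ the R-child body ⟹ the R-parent body; H2 by thmc-p1's `bdpValueAt₃_of_valueContinuity`.

HONEST FRAMING: implications only; (VC₃) and H3ᴮ are hypotheses, OPEN at `3 ∥ N`; nothing is discharged,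
booked or re-labelled (T7); O2 stays OPEN; BSD(E,3) is proved for no class.
References: [Castella2018] Thm. 3.2, Thm. 3.3 (arXiv:1704.06608 p. 9); cell audit ORIENT-AUDIT-19270 Q4 (a).
-/

noncomputable section

open scoped Classical Topology

open Filter WeierstrassCurve NumberField IsDedekindDomain Field PowerSeries
  Literature.NumberTheory.EllipticCurves Literature.NumberTheory.EllipticCurves.ModularForms
  Literature.NumberTheory.EllipticCurves.Rank1Residual
  Literature.NumberTheory.GaloisRepresentations Literature.NumberTheory.GaloisCohomology
  Summit.BirchSwinnertonDyer.Rank1Residual Summit.BirchSwinnertonDyer.Rank1Residual.X11b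
  Summit.BirchSwinnertonDyer.Rank1Residual.X11b.AcSelmer
  Summit.BirchSwinnertonDyer.Rank1Residual.X11b.CongruenceLimit
  Summit.BirchSwinnertonDyer.Rank1Residual.X11b.Halves
  Summit.BirchSwinnertonDyer.Rank1Residual.X11b.Three

-- the cell's Theorems namespace repeats the summit name (Summit.<Summit>.<Problem>), as in every sibling file
set_option linter.dupNamespace false

namespace Summit.BirchSwinnertonDyer.BirchSwinnertonDyer.Theorems

/-- **(VC₃) for every curve ∧ the ORIENTED two-loci H3 ⟹ the ORIENTED halves parent** («HalvesAtThreeR»: for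
`E ∈ X11b` at 3, on (ram) ∧ 3 split and on ¬(ram) ∧ surj, `BDPValueAt₃ W ∧ IMCDivAt₃B W`). H2 on both loci is
thmc-p1's `bdpValueAt₃_of_valueContinuity`; H3ᴮ is passed through. Twin of
`classRecordThree_halvesAtThree_of_valueContinuity_of_imcDivStub` (p421546). CONDITIONAL on both hypotheses.
[cite: Castella2018, Thm. 3.2 and Thm. 3.3 (arXiv:1704.06608 p. 9) (shapes only; both halves open at p = 3)] -/
theorem classRecordThree_halvesAtThree_of_valueContinuity_of_imcDivStubB
    (hVC : ∀ (W : WeierstrassCurve ℚ) [W.IsElliptic] [W.IsGloballyMinimal],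
      ∀ (N : ℕ) [NeZero N] (K : Type) [Field K] [NumberField K] (Dt : ModularParametrizationData W N)
      (H : HeegnerDatum N (NumberField.discr K)) (ι : K →+* ℂ) (P : (W.baseChange K).toAffine.Point),
      ClassX11b W 3 → Surj W 3 → W.conductorNorm ℤ = N → IsImaginaryQuadratic K →
      Odd (NumberField.discr K) → SatisfiesHeegnerHypothesis N K →
      (W.quadraticTwist (NumberField.discr K : ℚ)).entireLFunction 1 ≠ 0 →
      WeierstrassCurve.Affine.Point.map ι.toRatAlgHom P = heegnerPointComplex Dt H →
      ¬ (3 : ℤ) ∣ Dt.c → ¬ IsOfFinAddOrder P →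
      ∀ (κ : ZpExtension K 3), κ.IsAnticyclotomic →
        ∀ (γ : Field.absoluteGaloisGroup K) [Fact (κ.IsTopGenerator γ)]
          (𝔭 : HeightOneSpectrum (𝓞 K)) (h𝔭 : ((3 : ℕ) : 𝓞 K) ∈ 𝔭.asIdeal)
          (he : 𝔭.asIdeal.ramificationIdx (𝓞 ℚ) = 1) (hf : 𝔭.asIdeal.inertiaDeg (𝓞 ℚ) = 1),
          ∀ (f : CuspForm (CongruenceSubgroup.Gamma0 N) 2), IsNewformOf W f →
            ∀ (ι' : PadicAlgCl 3 ≃+* ℂ), InducesPrime ι' 𝔭 →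
              ∃ (ΩK : ℂ) (Ωp : ℂ_[3]) (u : (unrIntegers 3)ˣ), ΩK ≠ 0 ∧ Ωp ≠ 0 ∧
                ∀ (φ : ℕ → HeckeCharacter K) (n : ℕ → ℕ) (r : ℕ → FramedGaloisRep K (PadicAlgCl 3) 1),
                  (∀ k, 0 < n k) → (∀ k (v : HeightOneSpectrum (𝓞 K)), (φ k).IsUnramifiedAt v) →
                  (∀ k, (φ k).HasInfinityType (fun _ ↦ (n k : ℤ)) (fun _ ↦ -(n k : ℤ))) →
                  (∀ k, IsPAdicAvatarOf ι' (φ k) (r k)) → (∀ k, FactorsThroughZp κ (r k)) →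
                  Tendsto (fun k ↦ avatarValueAt (r k) γ) atTop (𝓝 1) →
                  Tendsto (fun k ↦ ((ι'.symm (bdpInterpolationValue 3 f 𝔭 (φ k) (n k) ΩK) :
                    PadicAlgCl 3) : ℂ_[3]) * Ωp ^ (4 * n k)) atTop
                    (𝓝 (((u : unrIntegers 3) : ℂ_[3]) *
                      (algebraMap ℚ_[3] ℂ_[3] (((1 : ℚ_[3]) - ((W.LFunction 3 : ℤ) : ℚ_[3]) *
                        (3 : ℚ_[3])⁻¹) * logOmega W 3 (embAt K 3 𝔭 h𝔭 he hf) P)) ^ 2)))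
    (h3 : ∀ (W : WeierstrassCurve ℚ) [W.IsElliptic] [W.IsGloballyMinimal], ClassX11b W 3 →
      (Ram W 3 → W.HasSplitMultiplicativeReductionAtPrime 3 → IMCDivAt₃B W) ∧
        (¬ Ram W 3 → Surj W 3 → IMCDivAt₃B W)) :
    ∀ (W : WeierstrassCurve ℚ) [W.IsElliptic] [W.IsGloballyMinimal],
      Summit.BirchSwinnertonDyer.Rank1Residual.ClassX11b W 3 →
        (Literature.NumberTheory.EllipticCurves.Rank1Residual.Ram W 3 →
            W.HasSplitMultiplicativeReductionAtPrime 3 →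
              Summit.BirchSwinnertonDyer.Rank1Residual.X11b.Three.BDPValueAt₃ W ∧
                Summit.BirchSwinnertonDyer.Rank1Residual.X11b.Three.IMCDivAt₃B W) ∧
          (¬ Literature.NumberTheory.EllipticCurves.Rank1Residual.Ram W 3 →
            Literature.NumberTheory.EllipticCurves.Rank1Residual.Surj W 3 →
              Summit.BirchSwinnertonDyer.Rank1Residual.X11b.Three.BDPValueAt₃ W ∧
                Summit.BirchSwinnertonDyer.Rank1Residual.X11b.Three.IMCDivAt₃B W) := by
  intro W _ _ hX
  obtain ⟨hI₁, hI₂⟩ := h3 W hX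
  exact ⟨fun hr hs ↦ ⟨bdpValueAt₃_of_valueContinuity (hVC W), hI₁ hr hs⟩,
    fun hnr hsu ↦ ⟨bdpValueAt₃_of_valueContinuity (hVC W), hI₂ hnr hsu⟩⟩

end Summit.BirchSwinnertonDyer.BirchSwinnertonDyer.Theorems

end
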